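import Literature.NumberTheory.LFunctions.MellinPlancherel
import Mathlib.NumberTheory.Chebyshev
import Literature.NumberTheory.LFunctions.MertensTail
import Literature.NumberTheory.LFunctions.PrimeNumberTheoremErrorTermProofs
import Literature.NumberTheory.LFunctions.HalaszRestrictedMeanSquare
import HarnessLib

/-!
# Mellin–Plancherel for short multiplicative differences of partial sums

For a coefficient sequence `a : ℕ → ℂ` with `∑ |a_n| n^{-σ} < ∞` (`σ > 0`) and partial sums
`A(y) = ∑_{n ≤ y} a_n` of growth `|A(y)| ≤ C y^θ` (`θ < σ`), and a ratio `ρ ≥ 1`, the function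
`Φ(u) = e^{-σu} (A(ρ e^u) - A(e^u))` — the exponentially damped sum of `a_n` over the SHORT
multiplicative window `(e^u, ρ e^u]` — is `ρ^σ φ(u + log ρ) - φ(u)` with `φ(u) = e^{-σu} A(e^u)` the function of
`MellinPlancherel.lean`, so its Fourier transform is `(ρ^s - 1) L(s)/s`, `s = σ + 2πiξ`
(`MellinPlancherel.fourier_phi` and the translation rule), and Plancherel gives

`∫_ℝ |A(ρ e^u) - A(e^u)|² e^{-2σu} du = (1/2π) ∫_ℝ |ρ^{σ+iy} - 1|² |L(σ+iy)|²/|σ+iy|² dy`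

(`integral_norm_sq_psumDiff_exp`).  The multiplier `|ρ^s - 1|²/|s|²` is `≤ (ρ - 1)² ρ^{2σ}`-ish for
small `|y|` and `≤ (ρ^σ + 1)²/|s|²` always (`norm_cpow_sub_one_le`); it is the device by which the
Granville–Soundararajan proof of Halász's theorem is run for sums over short intervals `(x, ρx]`
(`HalaszRestrictedShort*.lean`): mean values of Dirichlet series against this multiplier are, read
backwards, mean squares of short-interval sums of the coefficients, where the prime number theorem in
short intervals is available.

## Main results
- `MellinPlancherel.fourier_phiDiff` : `𝓕Φ(ξ) = (ρ^s - 1) L(s)/s`.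
- `MellinPlancherel.integral_norm_sq_psumDiff_exp` : the displayed identity.
- `MellinPlancherel.norm_cpow_sub_one_le` : `|ρ^s - 1| ≤ ρ^{Re s} + 1`.
- `MellinPlancherel.integral_norm_sq_psumDiff_prime_le` (`…_of_le`) : for `c` supported on primes with
  `|c(p)| ≤ log p` (resp. and `p ≤ Q`), `ρ = 1 + δ`, and `θ(ρy) - θ(y) ≤ 2δy` beyond `e^{u₀}`:
  `∫ |C(ρe^u) - C(e^u)|² e^{-2(1+α)u} du ≤ (u₀+1)²(2δ²u₀+1) + 2δ²/α` (resp. `+ 4δ² log Q`), and the same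
  bounds for `∫ |ρ^s - 1|² |L_c(s)|²/|s|² dy / 2π` on `Re s = 1 + α`
  (`integral_mult_normSq_LSeries_prime_le`, `…_of_le`).
- `MellinPlancherel.exists_theta_shortInterval_le` : the prime number theorem in short intervals in that
  form (`θ((1+δ)y) - θ(y) ≤ 2δy` once `log² y ≥ C/δ`), from the tree's de la Vallée Poussin theorem.
- `MellinPlancherel.norm_LSeries_primePow_le` : the prime powers `p^k`, `k ≥ 2`, of `Λ` give a Dirichlet
  series bounded by `2` on `Re s ≥ 1`.

## References
- [MontgomeryVaughan2007] H. L. Montgomery, R. C. Vaughan, *Multiplicative Number Theory I*, §5.1,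
  Theorem 5.4 (Plancherel for Dirichlet series).
- [GranvilleSoundararajan2003] A. Granville, K. Soundararajan, *Decay of mean values of multiplicative
  functions*, Canad. J. Math. 55 (2003), §3b, (3.8) (the case `ρ = ∞`, i.e. `φ` itself).

## Design choices
* Everything is stated for a real ratio `ρ ≥ 1` (in the application `ρ = 1 + 1/T`); no smoothing.
* The hypotheses are those of `MellinPlancherel.integral_norm_sq_psum_exp` verbatim.
-/

noncomputable section

open MeasureTheory Real Complex Finset Set Filter FourierTransform

namespace Literature.NumberTheory.LFunctions

namespace MellinPlancherel

/-! ### The short difference and its damped version -/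

/-! We write `A(ρ y) - A(y) = psum a (ρ * y) - psum a y = ∑_{y < n ≤ ρ y} a_n` (for `ρ ≥ 1`) and
`Φ(u) = e^{-σu} (A(ρ e^u) - A(e^u))`; to keep this file free of definitions both are spelled out
(`Φ` below always denotes this lambda, written in full). -/

variable {a : ℕ → ℂ} {σ θ C ρ : ℝ}


/-- `‖Φ(u)‖ = e^{-σu} ‖A(ρe^u) - A(e^u)‖`. [folklore] -/
theorem norm_phiDiff (a : ℕ → ℂ) (σ ρ u : ℝ) :
    ‖((fun u : ℝ => (Real.exp (-(σ * u)) : ℂ) * (psum a (ρ * Real.exp u) - psum a (Real.exp u))) u)‖ = Real.exp (-(σ * u)) * ‖psum a (ρ * Real.exp u) - psum a (Real.exp u)‖ := by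
  simp only
  rw [norm_mul, Complex.norm_real, Real.norm_of_nonneg (Real.exp_pos _).le]

/-- **`Φ` in terms of `φ`**: `Φ(u) = ρ^σ φ(u + log ρ) - φ(u)` (`ρ > 0`). [folklore] -/
theorem phiDiff_eq (hρ : 0 < ρ) (u : ℝ) :
    ((fun u : ℝ => (Real.exp (-(σ * u)) : ℂ) * (psum a (ρ * Real.exp u) - psum a (Real.exp u))) u) = ((ρ ^ σ : ℝ) : ℂ) * phi a σ (u + Real.log ρ) - phi a σ u := by
  unfold phi
  simp only
  have h1 : Real.exp (u + Real.log ρ) = ρ * Real.exp u := by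
    rw [Real.exp_add, Real.exp_log hρ]; ring
  have h2 : ((ρ ^ σ : ℝ) : ℂ) * (Real.exp (-(σ * (u + Real.log ρ))) : ℂ) = (Real.exp (-(σ * u)) : ℂ) := by
    rw [← Complex.ofReal_mul]
    congr 1
    rw [Real.rpow_def_of_pos hρ, ← Real.exp_add]
    congr 1; ring
  rw [h1, mul_sub, ← mul_assoc, h2]

/-- `Φ` is measurable. [folklore] -/
theorem measurable_phiDiff (a : ℕ → ℂ) (σ : ℝ) (hρ : 0 < ρ) : Measurable (fun u : ℝ => (Real.exp (-(σ * u)) : ℂ) * (psum a (ρ * Real.exp u) - psum a (Real.exp u))) := by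
  have h : (fun u : ℝ => (Real.exp (-(σ * u)) : ℂ) * (psum a (ρ * Real.exp u) - psum a (Real.exp u))) = fun u => ((ρ ^ σ : ℝ) : ℂ) * phi a σ (u + Real.log ρ) - phi a σ u :=
    funext fun u => phiDiff_eq hρ u
  rw [h]
  exact (((measurable_phi a σ).comp (measurable_id.add_const _)).const_mul _).sub (measurable_phi a σ)

/-- `Φ ∈ L¹(ℝ)` under the growth bound `|A(y)| ≤ C y^θ`, `θ < σ`. [folklore] -/
theorem integrable_phiDiff (hbd : ∀ y : ℝ, 1 ≤ y → ‖psum a y‖ ≤ C * y ^ θ) (hθ : θ < σ) (hρ : 0 < ρ) :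
    Integrable (fun u : ℝ => (Real.exp (-(σ * u)) : ℂ) * (psum a (ρ * Real.exp u) - psum a (Real.exp u))) := by
  have h : (fun u : ℝ => (Real.exp (-(σ * u)) : ℂ) * (psum a (ρ * Real.exp u) - psum a (Real.exp u))) = fun u => ((ρ ^ σ : ℝ) : ℂ) * phi a σ (u + Real.log ρ) - phi a σ u :=
    funext fun u => phiDiff_eq hρ u
  rw [h]
  exact (((integrable_phi hbd hθ).comp_add_right (Real.log ρ)).const_mul _).sub (integrable_phi hbd hθ)

/-- `‖Φ(u)‖ ≤ (ρ^σ + 1) C`. [folklore] -/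
theorem norm_phiDiff_le_const (hbd : ∀ y : ℝ, 1 ≤ y → ‖psum a y‖ ≤ C * y ^ θ) (hθ : θ < σ) (hρ : 0 < ρ)
    (u : ℝ) : ‖((fun u : ℝ => (Real.exp (-(σ * u)) : ℂ) * (psum a (ρ * Real.exp u) - psum a (Real.exp u))) u)‖ ≤ (ρ ^ σ + 1) * C := by
  rw [phiDiff_eq hρ]
  have h1 := norm_phi_le_const hbd hθ (u + Real.log ρ)
  have h2 := norm_phi_le_const hbd hθ u
  have hρσ : 0 ≤ ρ ^ σ := Real.rpow_nonneg hρ.le σ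
  calc ‖((ρ ^ σ : ℝ) : ℂ) * phi a σ (u + Real.log ρ) - phi a σ u‖
      ≤ ‖((ρ ^ σ : ℝ) : ℂ) * phi a σ (u + Real.log ρ)‖ + ‖phi a σ u‖ := norm_sub_le _ _
    _ = ρ ^ σ * ‖phi a σ (u + Real.log ρ)‖ + ‖phi a σ u‖ := by
        rw [norm_mul, Complex.norm_real, Real.norm_of_nonneg hρσ]
    _ ≤ ρ ^ σ * C + C := by gcongr
    _ = (ρ ^ σ + 1) * C := by ring

/-- `Φ ∈ L²(ℝ)` (bounded and integrable). [folklore] -/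
theorem memLp_two_phiDiff (hbd : ∀ y : ℝ, 1 ≤ y → ‖psum a y‖ ≤ C * y ^ θ) (hθ : θ < σ) (hρ : 0 < ρ) :
    MemLp (fun u : ℝ => (Real.exp (-(σ * u)) : ℂ) * (psum a (ρ * Real.exp u) - psum a (Real.exp u))) 2 :=
  Literature.NumberTheory.LFunctions.WindowPlancherel.memLp_two_of_norm_le (integrable_phiDiff hbd hθ hρ)
    (norm_phiDiff_le_const hbd hθ hρ)

/-! ### The Fourier transform of `Φ` -/

/-- Translation rule: `𝓕(φ(· + c))(ξ) = 𝐞(cξ) 𝓕φ(ξ)` (substitute `v ↦ v - c`). [folklore] -/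
theorem fourier_phi_comp_add (a : ℕ → ℂ) (σ c ξ : ℝ) :
    𝓕 (fun u : ℝ => phi a σ (u + c)) ξ = (𝐞 (c * ξ) : ℂ) * 𝓕 (phi a σ) ξ := by
  rw [Real.fourier_real_eq, Real.fourier_real_eq]
  set G : ℝ → ℂ := fun w => (𝐞 (-((w - c) * ξ)) : ℂ) * phi a σ w with hG
  have h1 : (fun v : ℝ => 𝐞 (-(v * ξ)) • phi a σ (v + c)) = fun v => G (v + c) := by
    funext v
    simp only [hG, Circle.smul_def, smul_eq_mul, add_sub_cancel_right]
  have h2 : ∀ w : ℝ, G w = (𝐞 (c * ξ) : ℂ) * (𝐞 (-(w * ξ)) • phi a σ w) := by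
    intro w
    simp only [hG, Circle.smul_def, smul_eq_mul, ← mul_assoc, ← Circle.coe_mul, ← AddChar.map_add_eq_mul]
    congr 2; ring
  rw [h1, integral_add_right_eq_self G c]
  simp_rw [h2]
  rw [integral_const_mul]

variable (hσ : 0 < σ) (hsum : Summable fun n : ℕ => ‖a n‖ / (n : ℝ) ^ σ)
include hσ hsum

omit hσ hsum in
/-- For real `ρ > 0` and `s = σ + 2πiξ`: `ρ^σ 𝐞(ξ log ρ) = ρ^s`. [folklore] -/
theorem rpow_mul_fourierChar_eq_cpow (hρ : 0 < ρ) (σ ξ : ℝ) :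
    ((ρ ^ σ : ℝ) : ℂ) * (𝐞 (Real.log ρ * ξ) : ℂ) = (ρ : ℂ) ^ ((σ : ℂ) + (2 * π * ξ : ℝ) * I) := by
  rw [Complex.ofReal_cpow hρ.le, Real.fourierChar_apply, Complex.cpow_def_of_ne_zero
    (by exact_mod_cast hρ.ne'), ← Complex.ofReal_log hρ.le, ← Complex.exp_add,
    Complex.cpow_def_of_ne_zero (by exact_mod_cast hρ.ne'), ← Complex.ofReal_log hρ.le]
  congr 1
  push_cast
  ring

/-- **The Fourier transform of `Φ`**: `𝓕Φ(ξ) = (ρ^s - 1) L(s)/s` with `s = σ + 2πiξ`. [folklore] -/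
theorem fourier_phiDiff (hbd : ∀ y : ℝ, 1 ≤ y → ‖psum a y‖ ≤ C * y ^ θ) (hθ : θ < σ) (hρ : 0 < ρ) (ξ : ℝ) :
    𝓕 (fun u : ℝ => (Real.exp (-(σ * u)) : ℂ) * (psum a (ρ * Real.exp u) - psum a (Real.exp u))) ξ =
      ((ρ : ℂ) ^ ((σ : ℂ) + (2 * π * ξ : ℝ) * I) - 1) *
        (LSeries a (σ + (2 * π * ξ : ℝ) * I) / (σ + (2 * π * ξ : ℝ) * I)) := by
  have h : (fun u : ℝ => (Real.exp (-(σ * u)) : ℂ) * (psum a (ρ * Real.exp u) - psum a (Real.exp u))) = fun u => ((ρ ^ σ : ℝ) : ℂ) * phi a σ (u + Real.log ρ) - phi a σ u :=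
    funext fun u => phiDiff_eq hρ u
  have hint1 : Integrable (fun u : ℝ => ((ρ ^ σ : ℝ) : ℂ) * phi a σ (u + Real.log ρ)) :=
    ((integrable_phi hbd hθ).comp_add_right (Real.log ρ)).const_mul _
  have hint2 : Integrable (phi a σ) := integrable_phi hbd hθ
  -- linearity of `𝓕`
  have hlin : 𝓕 (fun u : ℝ => (Real.exp (-(σ * u)) : ℂ) * (psum a (ρ * Real.exp u) - psum a (Real.exp u))) ξ =
      ((ρ ^ σ : ℝ) : ℂ) * 𝓕 (fun u : ℝ => phi a σ (u + Real.log ρ)) ξ - 𝓕 (phi a σ) ξ := by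
    rw [h, Real.fourier_real_eq, Real.fourier_real_eq, Real.fourier_real_eq]
    have e1 : (fun v : ℝ => 𝐞 (-(v * ξ)) • (((ρ ^ σ : ℝ) : ℂ) * phi a σ (v + Real.log ρ) - phi a σ v)) =
        fun v : ℝ => ((ρ ^ σ : ℝ) : ℂ) * (𝐞 (-(v * ξ)) • phi a σ (v + Real.log ρ)) -
          𝐞 (-(v * ξ)) • phi a σ v := by
      funext v
      simp only [Circle.smul_def, smul_eq_mul]
      ring
    have hb : MemLp (fun v : ℝ => (Real.fourierChar (-(v * ξ)) : ℂ)) ⊤ volume := by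
      refine memLp_top_of_bound (by fun_prop) 1 (Filter.Eventually.of_forall fun v => ?_)
      simp
    have i1 : Integrable (fun v : ℝ => ((ρ ^ σ : ℝ) : ℂ) * (𝐞 (-(v * ξ)) • phi a σ (v + Real.log ρ))) := by
      refine (hint1.smul_of_top_left hb).congr (Filter.Eventually.of_forall fun v => ?_)
      simp only [Pi.smul_apply', Circle.smul_def, smul_eq_mul]
      ring
    have i2 : Integrable (fun v : ℝ => 𝐞 (-(v * ξ)) • phi a σ v) := by
      refine (hint2.smul_of_top_left hb).congr (Filter.Eventually.of_forall fun v => ?_)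
      simp only [Pi.smul_apply', Circle.smul_def, smul_eq_mul]
      ring
    rw [e1, integral_sub i1 i2, integral_const_mul]
  rw [hlin, fourier_phi_comp_add, fourier_phi hσ hsum, ← mul_assoc, rpow_mul_fourierChar_eq_cpow hρ]
  ring

/-! ### Plancherel -/

/-- **Mellin–Plancherel for short differences**: for `ℓ¹`-weighted coefficients (`∑ |a_n| n^{-σ} < ∞`,
`σ > 0`) whose partial sums satisfy `|A(y)| ≤ C y^θ` (`y ≥ 1`) for some `θ < σ`, and `ρ > 0`,
`∫ |A(ρe^u) - A(e^u)|² e^{-2σu} du = (1/2π) ∫ |ρ^{σ+iy} - 1|² |L(σ+iy)|²/|σ+iy|² dy`.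
[cite: MontgomeryVaughan2007, Theorem 5.4] -/
theorem integral_norm_sq_psumDiff_exp (hθ : θ < σ) (hbd : ∀ y : ℝ, 1 ≤ y → ‖psum a y‖ ≤ C * y ^ θ)
    (hρ : 0 < ρ) :
    ∫ u : ℝ, ‖psum a (ρ * Real.exp u) - psum a (Real.exp u)‖ ^ 2 * Real.exp (-(2 * σ * u)) =
      (1 / (2 * π)) * ∫ y : ℝ, ‖(ρ : ℂ) ^ ((σ : ℂ) + y * I) - 1‖ ^ 2 *
        ‖LSeries a (σ + y * I)‖ ^ 2 / ‖(σ : ℂ) + y * I‖ ^ 2 := by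
  have hP := Literature.Analysis.FunctionSpaces.integral_norm_sq_fourierIntegral_eq
    (integrable_phiDiff hbd hθ hρ) (memLp_two_phiDiff hbd hθ hρ)
  -- right-hand side of Plancherel
  have hR : ∫ u : ℝ, ‖((fun u : ℝ => (Real.exp (-(σ * u)) : ℂ) * (psum a (ρ * Real.exp u) - psum a (Real.exp u))) u)‖ ^ 2 =
      ∫ u : ℝ, ‖psum a (ρ * Real.exp u) - psum a (Real.exp u)‖ ^ 2 * Real.exp (-(2 * σ * u)) := by
    refine integral_congr_ae (Filter.Eventually.of_forall fun u => ?_)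
    simp only [norm_phiDiff]
    rw [mul_pow, ← Real.exp_nat_mul]
    ring_nf
  -- left-hand side of Plancherel
  set G : ℝ → ℝ := fun y => ‖(ρ : ℂ) ^ ((σ : ℂ) + y * I) - 1‖ ^ 2 *
    ‖LSeries a (σ + y * I)‖ ^ 2 / ‖(σ : ℂ) + y * I‖ ^ 2 with hG
  have hL : ∫ ξ : ℝ, ‖𝓕 (fun u : ℝ => (Real.exp (-(σ * u)) : ℂ) * (psum a (ρ * Real.exp u) - psum a (Real.exp u))) ξ‖ ^ 2 = ∫ ξ : ℝ, G ((2 * π) * ξ) := by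
    refine integral_congr_ae (Filter.Eventually.of_forall fun ξ => ?_)
    simp only [hG]
    rw [fourier_phiDiff hσ hsum hbd hθ hρ, norm_mul, norm_div, mul_pow, div_pow]
    push_cast
    ring
  have h2π : |(2 * π)⁻¹| = 1 / (2 * π) := by rw [abs_of_pos (by positivity), one_div]
  rw [← hR, ← hP, hL, Measure.integral_comp_mul_left G, h2π, smul_eq_mul]

/-! ### The multiplier `ρ^s - 1` -/

omit hσ hsum in
/-- `|ρ^s - 1| ≤ ρ^{Re s} + 1` for real `ρ > 0`. [folklore] -/
theorem norm_cpow_sub_one_le (hρ : 0 < ρ) (s : ℂ) : ‖(ρ : ℂ) ^ s - 1‖ ≤ ρ ^ s.re + 1 := by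
  calc ‖(ρ : ℂ) ^ s - 1‖ ≤ ‖(ρ : ℂ) ^ s‖ + ‖(1 : ℂ)‖ := norm_sub_le _ _
    _ = ρ ^ s.re + 1 := by
        rw [Complex.norm_cpow_eq_rpow_re_of_pos hρ, norm_one]

omit hσ hsum in
/-- For `1 ≤ ρ ≤ 2` and `Re s ≤ 2`: `|ρ^s - 1| ≤ 5`. [folklore] -/
theorem norm_cpow_sub_one_le_five (hρ1 : 1 ≤ ρ) (hρ2 : ρ ≤ 2) {s : ℂ} (hs : s.re ≤ 2) :
    ‖(ρ : ℂ) ^ s - 1‖ ≤ 5 := by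
  have hρ : 0 < ρ := by linarith
  refine (norm_cpow_sub_one_le hρ s).trans ?_
  have h1 : ρ ^ s.re ≤ ρ ^ (2 : ℝ) := Real.rpow_le_rpow_of_exponent_le hρ1 hs
  have h2 : ρ ^ (2 : ℝ) ≤ 4 := by
    rw [Real.rpow_two]; nlinarith
  linarith

/-! ### Prime-supported coefficients: short differences and Chebyshev's `θ` -/

variable {c : ℕ → ℂ}

/-! Throughout, "`c` is prime-supported" is the hypothesis
`hc : ∀ n, ‖c n‖ ≤ if n.Prime then log n else 0` (e.g. the prime part of `g(n)Λ(n)`). -/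

omit hσ hsum in
/-- `A(y') - A(y) = ∑_{⌊y⌋ < n ≤ ⌊y'⌋} a_n` when `⌊y⌋ ≤ ⌊y'⌋`. [folklore] -/
theorem psum_sub_psum_eq (a : ℕ → ℂ) {y y' : ℝ} (h : ⌊y⌋₊ ≤ ⌊y'⌋₊) :
    psum a y' - psum a y = ∑ n ∈ Finset.Ioc ⌊y⌋₊ ⌊y'⌋₊, a n := by
  unfold psum
  have h1 : Finset.Icc 1 ⌊y'⌋₊ = Finset.Ioc 0 ⌊y'⌋₊ := rfl
  have h2 : Finset.Icc 1 ⌊y⌋₊ = Finset.Ioc 0 ⌊y⌋₊ := rfl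
  rw [h1, h2, ← Finset.sum_Ioc_consecutive a (Nat.zero_le _) h]
  ring

omit hσ hsum in
/-- `θ(y') - θ(y) = ∑_{⌊y⌋ < p ≤ ⌊y'⌋} log p` when `⌊y⌋ ≤ ⌊y'⌋`. [folklore] -/
theorem theta_sub_theta_eq {y y' : ℝ} (h : ⌊y⌋₊ ≤ ⌊y'⌋₊) :
    Chebyshev.theta y' - Chebyshev.theta y = ∑ p ∈ (Finset.Ioc ⌊y⌋₊ ⌊y'⌋₊).filter Nat.Prime, Real.log p := by
  unfold Chebyshev.theta
  rw [Finset.sum_filter, Finset.sum_filter, Finset.sum_filter,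
    ← Finset.sum_Ioc_consecutive _ (Nat.zero_le _) h]
  ring

omit hσ hsum in
/-- **Short differences of a prime-supported sequence are dominated by `θ`**:
`‖A(y') - A(y)‖ ≤ θ(y') - θ(y)` for `y ≤ y'`. [folklore] -/
theorem norm_psum_sub_psum_le_theta (hc : ∀ n : ℕ, ‖c n‖ ≤ if n.Prime then Real.log n else 0) {y y' : ℝ} (hyy' : y ≤ y') :
    ‖psum c y' - psum c y‖ ≤ Chebyshev.theta y' - Chebyshev.theta y := by
  have h : ⌊y⌋₊ ≤ ⌊y'⌋₊ := Nat.floor_le_floor hyy'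
  rw [psum_sub_psum_eq c h, theta_sub_theta_eq h, Finset.sum_filter]
  refine (norm_sum_le _ _).trans (Finset.sum_le_sum fun n _ => ?_)
  have := hc n
  split_ifs with hp
  · simpa [hp] using this
  · simpa [hp] using this

omit hσ hsum in
/-- `c(1) = 0` for a prime-supported sequence (indeed `c(n) = 0` at every non-prime). [folklore] -/
theorem eq_zero_of_not_prime_of_primeLogBound (hc : ∀ n : ℕ, ‖c n‖ ≤ if n.Prime then Real.log n else 0) {n : ℕ} (hn : ¬ n.Prime) : c n = 0 := by
  have := hc n
  rw [if_neg hn] at this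
  exact norm_le_zero_iff.1 this

omit hσ hsum in
/-- **Crude bound**: `θ(y') - θ(y) ≤ (y' - y + 1) log y'` for `1 ≤ y ≤ y'` (at most `⌊y'⌋ - ⌊y⌋ ≤ y' - y + 1`
primes, each with `log p ≤ log y'`). [folklore] -/
theorem theta_sub_theta_le_crude {y y' : ℝ} (hy : 1 ≤ y) (hyy' : y ≤ y') :
    Chebyshev.theta y' - Chebyshev.theta y ≤ (y' - y + 1) * Real.log y' := by
  have h : ⌊y⌋₊ ≤ ⌊y'⌋₊ := Nat.floor_le_floor hyy'
  have hy' : 1 ≤ y' := hy.trans hyy'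
  rw [theta_sub_theta_eq h]
  have hlog : ∀ p ∈ (Finset.Ioc ⌊y⌋₊ ⌊y'⌋₊).filter Nat.Prime, Real.log p ≤ Real.log y' := by
    intro p hp
    simp only [Finset.mem_filter, Finset.mem_Ioc] at hp
    have hp1 : (1 : ℝ) ≤ p := by exact_mod_cast hp.2.one_lt.le
    exact Real.log_le_log (by linarith) ((Nat.cast_le.2 hp.1.2).trans (Nat.floor_le (by linarith)))
  calc ∑ p ∈ (Finset.Ioc ⌊y⌋₊ ⌊y'⌋₊).filter Nat.Prime, Real.log p
      ≤ ∑ p ∈ (Finset.Ioc ⌊y⌋₊ ⌊y'⌋₊).filter Nat.Prime, Real.log y' := Finset.sum_le_sum hlog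
    _ = ((Finset.Ioc ⌊y⌋₊ ⌊y'⌋₊).filter Nat.Prime).card * Real.log y' := by
        rw [Finset.sum_const, nsmul_eq_mul]
    _ ≤ (Finset.Ioc ⌊y⌋₊ ⌊y'⌋₊).card * Real.log y' := by
        gcongr
        · exact Real.log_nonneg hy'
        · exact Finset.filter_subset _ _
    _ ≤ (y' - y + 1) * Real.log y' := by
        gcongr
        · exact Real.log_nonneg hy'
        · rw [Nat.card_Ioc, Nat.cast_sub h]
          have h1 : (⌊y'⌋₊ : ℝ) ≤ y' := Nat.floor_le (by linarith)
          have h2 : y - 1 < (⌊y⌋₊ : ℝ) := by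
            have := Nat.lt_floor_add_one y; linarith
          linarith

omit hσ hsum in
/-- The short difference over `(e^u, ρ e^u]` vanishes for `u < 0` (`ρ ≤ 2`, `c(1) = 0`): the window
lies in `(0, 2)` and contains at most the integer `1`. [folklore] -/
theorem psumDiff_exp_of_neg (hc1 : c 1 = 0) (hρ2 : ρ ≤ 2) {u : ℝ} (hu : u < 0) :
    psum c (ρ * Real.exp u) - psum c (Real.exp u) = 0 := by
  have he : Real.exp u < 1 := Real.exp_lt_one_iff.mpr hu
  rw [psum_of_lt_one c he, sub_zero]
  unfold psum
  have hlt : ρ * Real.exp u < 2 := by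
    have h0 := Real.exp_pos u
    nlinarith
  have hfl : ⌊ρ * Real.exp u⌋₊ ≤ 1 :=
    Nat.lt_succ_iff.mp ((Nat.floor_lt' (by norm_num)).2 (by exact_mod_cast hlt))
  interval_cases h : ⌊ρ * Real.exp u⌋₊
  · simp
  · simp [hc1]

omit hσ hsum in
/-- If `c` is supported on `n ≤ Q` then the short difference over `(y, ρy]` vanishes for `y ≥ Q`. [folklore] -/
theorem psumDiff_eq_zero_of_ge {Q : ℝ} (hsupp : ∀ n : ℕ, c n ≠ 0 → (n : ℝ) ≤ Q) (hρ1 : 1 ≤ ρ) {y : ℝ}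
    (hQ : 0 ≤ Q) (hy : Q ≤ y) : psum c (ρ * y) - psum c y = 0 := by
  have hyy : y ≤ ρ * y := le_mul_of_one_le_left (hQ.trans hy) hρ1
  rw [psum_sub_psum_eq c (Nat.floor_le_floor hyy)]
  refine Finset.sum_eq_zero fun n hn => ?_
  by_contra h
  have h1 := hsupp n h
  simp only [Finset.mem_Ioc] at hn
  have h2 : y < n := by
    have := Nat.lt_of_floor_lt hn.1
    exact this
  linarith

omit hσ hsum in
/-- **Mean square of short differences of a prime-supported sequence.**  Let `|c(p)| ≤ log p` on primes,
`c = 0` elsewhere, `0 < δ ≤ 1`, `ρ = 1 + δ`, `α > 0`, and let `u₀ ≥ 0` be such that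
`θ(ρy) - θ(y) ≤ 2δy` for all `y ≥ e^{u₀}` (the prime number theorem in short intervals, available for
`u₀ ≫ √(1/δ)`).  Then
`∫_ℝ |A(ρe^u) - A(e^u)|² e^{-2(1+α)u} du ≤ (u₀ + 1)² (2δ²u₀ + 1) + 2δ²/α`:
on `0 ≤ u ≤ u₀` the crude bound `(δe^u + 1)(u + 1)`, beyond `u₀` the bound `2δe^u`.  (The plain mean value
theorem for `∑ c(n) n^{-s}` would give `δ²/α²` in place of `δ²/α` here.) [folklore] -/
theorem integral_norm_sq_psumDiff_prime_le (hc : ∀ n : ℕ, ‖c n‖ ≤ if n.Prime then Real.log n else 0) {δ : ℝ} (hδ0 : 0 < δ) (hδ1 : δ ≤ 1)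
    {α : ℝ} (hα : 0 < α) {u₀ : ℝ} (hu₀ : 0 ≤ u₀)
    (hPNT : ∀ y : ℝ, Real.exp u₀ ≤ y → Chebyshev.theta ((1 + δ) * y) - Chebyshev.theta y ≤ 2 * δ * y) :
    ∫ u : ℝ, ‖psum c ((1 + δ) * Real.exp u) - psum c (Real.exp u)‖ ^ 2 * Real.exp (-(2 * (1 + α) * u)) ≤
      (u₀ + 1) ^ 2 * (2 * δ ^ 2 * u₀ + 1) + 2 * δ ^ 2 / α := by
  set ρ : ℝ := 1 + δ with hρ
  have hρ1 : 1 ≤ ρ := by rw [hρ]; linarith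
  have hρ2 : ρ ≤ 2 := by rw [hρ]; linarith
  have hc1 : c 1 = 0 := eq_zero_of_not_prime_of_primeLogBound hc Nat.not_prime_one
  -- the three majorants
  set F₁ : ℝ → ℝ := (Set.Icc 0 u₀).indicator (fun _ => 2 * (u₀ + 1) ^ 2 * δ ^ 2) with hF₁
  set F₂ : ℝ → ℝ := (Set.Ici (0 : ℝ)).indicator (fun u => 2 * (u₀ + 1) ^ 2 * Real.exp (-2 * u)) with hF₂
  set F₃ : ℝ → ℝ := (Set.Ici (0 : ℝ)).indicator (fun u => 4 * δ ^ 2 * Real.exp (-(2 * α) * u)) with hF₃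
  have hF₁i : Integrable F₁ := by
    rw [hF₁, integrable_indicator_iff measurableSet_Icc]
    exact integrableOn_const (by rw [Real.volume_Icc]; exact ENNReal.ofReal_ne_top)
  have hF₂i : Integrable F₂ := by
    rw [hF₂, integrable_indicator_iff measurableSet_Ici, integrableOn_Ici_iff_integrableOn_Ioi]
    exact (integrableOn_exp_mul_Ioi (by norm_num : (-2 : ℝ) < 0) 0).const_mul _
  have hF₃i : Integrable F₃ := by
    rw [hF₃, integrable_indicator_iff measurableSet_Ici, integrableOn_Ici_iff_integrableOn_Ioi]
    exact (integrableOn_exp_mul_Ioi (by linarith : -(2 * α) < 0) 0).const_mul _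
  have hI₁ : ∫ u, F₁ u = 2 * (u₀ + 1) ^ 2 * δ ^ 2 * u₀ := by
    rw [hF₁, integral_indicator measurableSet_Icc, setIntegral_const, Real.volume_real_Icc_of_le hu₀,
      smul_eq_mul]
    ring
  have hI₂ : ∫ u, F₂ u = (u₀ + 1) ^ 2 := by
    rw [hF₂, integral_indicator measurableSet_Ici, integral_Ici_eq_integral_Ioi, integral_const_mul,
      integral_exp_mul_Ioi (by norm_num : (-2 : ℝ) < 0) 0]
    simp only [mul_zero, Real.exp_zero]
    ring
  have hI₃ : ∫ u, F₃ u = 2 * δ ^ 2 / α := by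
    rw [hF₃, integral_indicator measurableSet_Ici, integral_Ici_eq_integral_Ioi, integral_const_mul,
      integral_exp_mul_Ioi (by linarith : -(2 * α) < 0) 0]
    simp only [mul_zero, Real.exp_zero]
    field_simp
    ring
  -- the pointwise bound
  have hle : ∀ u : ℝ, ‖psum c (ρ * Real.exp u) - psum c (Real.exp u)‖ ^ 2 * Real.exp (-(2 * (1 + α) * u)) ≤ F₁ u + F₂ u + F₃ u := by
    intro u
    rcases lt_or_ge u 0 with hu | hu
    · rw [psumDiff_exp_of_neg hc1 hρ2 hu, norm_zero]
      have h1 : F₁ u = 0 := by rw [hF₁, Set.indicator_of_notMem]; simp [hu]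
      have h2 : F₂ u = 0 := by rw [hF₂, Set.indicator_of_notMem]; simpa using hu
      have h3 : F₃ u = 0 := by rw [hF₃, Set.indicator_of_notMem]; simpa using hu
      rw [h1, h2, h3]; simp
    have hy1 : (1 : ℝ) ≤ Real.exp u := by simpa using Real.one_le_exp hu
    have hy0 : (0 : ℝ) < Real.exp u := Real.exp_pos u
    have hyy : Real.exp u ≤ ρ * Real.exp u := le_mul_of_one_le_left hy0.le hρ1
    have hΔ : ‖psum c (ρ * Real.exp u) - psum c (Real.exp u)‖ ≤ Chebyshev.theta (ρ * Real.exp u) - Chebyshev.theta (Real.exp u) :=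
      norm_psum_sub_psum_le_theta hc hyy
    have hF₂u : F₂ u = 2 * (u₀ + 1) ^ 2 * Real.exp (-2 * u) := by rw [hF₂, Set.indicator_of_mem (Set.mem_Ici.2 hu)]
    have hF₃u : F₃ u = 4 * δ ^ 2 * Real.exp (-(2 * α) * u) := by rw [hF₃, Set.indicator_of_mem (Set.mem_Ici.2 hu)]
    have hexp2 : Real.exp u ^ 2 * Real.exp (-(2 * (1 + α) * u)) = Real.exp (-(2 * α) * u) := by
      rw [sq, ← Real.exp_add, ← Real.exp_add]; congr 1; ring
    have hexpα : Real.exp (-(2 * (1 + α) * u)) ≤ Real.exp (-2 * u) := Real.exp_le_exp.2 (by nlinarith)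
    rcases le_or_gt u u₀ with hu₀' | hu₀'
    · -- crude range
      have hF₁u : F₁ u = 2 * (u₀ + 1) ^ 2 * δ ^ 2 := by
        rw [hF₁, Set.indicator_of_mem (Set.mem_Icc.2 ⟨hu, hu₀'⟩)]
      have hcr := theta_sub_theta_le_crude hy1 hyy
      have hlog : Real.log (ρ * Real.exp u) ≤ u + 1 := by
        rw [Real.log_mul (by linarith) hy0.ne', Real.log_exp]
        have : Real.log ρ ≤ 1 := by
          calc Real.log ρ ≤ ρ - 1 := Real.log_le_sub_one_of_pos (by linarith)
            _ ≤ 1 := by linarith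
        linarith
      have hb : ‖psum c (ρ * Real.exp u) - psum c (Real.exp u)‖ ≤ (δ * Real.exp u + 1) * (u + 1) := by
        refine hΔ.trans (hcr.trans ?_)
        have h0 : 0 ≤ ρ * Real.exp u - Real.exp u + 1 := by nlinarith
        calc (ρ * Real.exp u - Real.exp u + 1) * Real.log (ρ * Real.exp u)
            ≤ (ρ * Real.exp u - Real.exp u + 1) * (u + 1) := mul_le_mul_of_nonneg_left hlog h0
          _ = (δ * Real.exp u + 1) * (u + 1) := by rw [hρ]; ring
      have hb0 : 0 ≤ (δ * Real.exp u + 1) * (u + 1) := by positivity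
      -- `‖Δ‖² e^{-2(1+α)u} ≤ (δ e^u + 1)² (u+1)² e^{-2u} ≤ 2 (u₀+1)² (δ² + e^{-2u})`
      have h1 : ‖psum c (ρ * Real.exp u) - psum c (Real.exp u)‖ ^ 2 * Real.exp (-(2 * (1 + α) * u)) ≤
          ((δ * Real.exp u + 1) * (u + 1)) ^ 2 * Real.exp (-2 * u) := by
        have := pow_le_pow_left₀ (norm_nonneg _) hb 2
        exact mul_le_mul this hexpα (Real.exp_pos _).le (by positivity)
      have h2 : ((δ * Real.exp u + 1) * (u + 1)) ^ 2 * Real.exp (-2 * u) ≤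
          2 * (u₀ + 1) ^ 2 * δ ^ 2 + 2 * (u₀ + 1) ^ 2 * Real.exp (-2 * u) := by
        have hu1 : (u + 1) ^ 2 ≤ (u₀ + 1) ^ 2 := pow_le_pow_left₀ (by linarith) (by linarith) 2
        have hsq : (δ * Real.exp u + 1) ^ 2 ≤ 2 * (δ * Real.exp u) ^ 2 + 2 := by
          nlinarith [sq_nonneg (δ * Real.exp u - 1)]
        have hee : (δ * Real.exp u) ^ 2 * Real.exp (-2 * u) = δ ^ 2 := by
          have h1 : Real.exp u ^ 2 * Real.exp (-2 * u) = 1 := by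
            rw [← Real.exp_nat_mul, ← Real.exp_add]
            convert Real.exp_zero using 2
            push_cast; ring
          calc (δ * Real.exp u) ^ 2 * Real.exp (-2 * u) = δ ^ 2 * (Real.exp u ^ 2 * Real.exp (-2 * u)) := by ring
            _ = δ ^ 2 := by rw [h1, mul_one]
        have he0 : 0 ≤ Real.exp (-2 * u) := (Real.exp_pos _).le
        calc ((δ * Real.exp u + 1) * (u + 1)) ^ 2 * Real.exp (-2 * u)
            = (δ * Real.exp u + 1) ^ 2 * (u + 1) ^ 2 * Real.exp (-2 * u) := by ring
          _ ≤ (2 * (δ * Real.exp u) ^ 2 + 2) * (u₀ + 1) ^ 2 * Real.exp (-2 * u) := by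
              gcongr
          _ = 2 * (u₀ + 1) ^ 2 * ((δ * Real.exp u) ^ 2 * Real.exp (-2 * u)) +
                2 * (u₀ + 1) ^ 2 * Real.exp (-2 * u) := by ring
          _ = 2 * (u₀ + 1) ^ 2 * δ ^ 2 + 2 * (u₀ + 1) ^ 2 * Real.exp (-2 * u) := by rw [hee]
      have h3 : 0 ≤ F₃ u := by rw [hF₃u]; positivity
      rw [hF₁u, hF₂u]
      linarith
    · -- PNT range
      have hF₁u : F₁ u = 0 := by
        rw [hF₁, Set.indicator_of_notMem]; simp only [Set.mem_Icc, not_and, not_le]; exact fun _ => hu₀'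
      have hyu₀ : Real.exp u₀ ≤ Real.exp u := Real.exp_le_exp.2 hu₀'.le
      have hb : ‖psum c (ρ * Real.exp u) - psum c (Real.exp u)‖ ≤ 2 * δ * Real.exp u := hΔ.trans (by rw [hρ]; exact hPNT _ hyu₀)
      have h1 : ‖psum c (ρ * Real.exp u) - psum c (Real.exp u)‖ ^ 2 * Real.exp (-(2 * (1 + α) * u)) ≤
          (2 * δ * Real.exp u) ^ 2 * Real.exp (-(2 * (1 + α) * u)) := by
        have := pow_le_pow_left₀ (norm_nonneg _) hb 2
        exact mul_le_mul_of_nonneg_right this (Real.exp_pos _).le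
      have h2 : (2 * δ * Real.exp u) ^ 2 * Real.exp (-(2 * (1 + α) * u)) = F₃ u := by
        rw [hF₃u, ← hexp2]; ring
      have h3 : 0 ≤ F₂ u := by rw [hF₂u]; positivity
      rw [hF₁u]
      linarith
  have hnonneg : 0 ≤ᵐ[volume] fun u : ℝ => ‖psum c (ρ * Real.exp u) - psum c (Real.exp u)‖ ^ 2 * Real.exp (-(2 * (1 + α) * u)) :=
    Filter.Eventually.of_forall fun u => by positivity
  calc ∫ u : ℝ, ‖psum c (ρ * Real.exp u) - psum c (Real.exp u)‖ ^ 2 * Real.exp (-(2 * (1 + α) * u))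
      ≤ ∫ u, (F₁ u + F₂ u + F₃ u) :=
        integral_mono_of_nonneg hnonneg ((hF₁i.add hF₂i).add hF₃i) (Filter.Eventually.of_forall hle)
    _ = (∫ u, F₁ u) + (∫ u, F₂ u) + ∫ u, F₃ u := by
        rw [integral_add (f := fun u => F₁ u + F₂ u) (g := F₃) (hF₁i.add hF₂i) hF₃i, integral_add hF₁i hF₂i]
    _ = (u₀ + 1) ^ 2 * (2 * δ ^ 2 * u₀ + 1) + 2 * δ ^ 2 / α := by rw [hI₁, hI₂, hI₃]; ring

omit hσ hsum in
/-- The pointwise bound in the crude range: for `0 ≤ u ≤ u₀`, `1 ≤ ρ ≤ 2`, `ρ = 1 + δ`,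
`‖Δ(e^u)‖² e^{-2(1+α)u} ≤ 2(u₀+1)²δ² + 2(u₀+1)² e^{-2u}`. [folklore] -/
theorem normSq_psumDiff_exp_le_crude (hc : ∀ n : ℕ, ‖c n‖ ≤ if n.Prime then Real.log n else 0) {δ : ℝ} (hδ0 : 0 ≤ δ) (hδ1 : δ ≤ 1)
    {α : ℝ} (hα : 0 ≤ α) {u₀ u : ℝ} (hu : 0 ≤ u) (huu₀ : u ≤ u₀) :
    ‖psum c ((1 + δ) * Real.exp u) - psum c (Real.exp u)‖ ^ 2 * Real.exp (-(2 * (1 + α) * u)) ≤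
      2 * (u₀ + 1) ^ 2 * δ ^ 2 + 2 * (u₀ + 1) ^ 2 * Real.exp (-2 * u) := by
  set ρ : ℝ := 1 + δ with hρ
  have hρ1 : 1 ≤ ρ := by rw [hρ]; linarith
  have hy1 : (1 : ℝ) ≤ Real.exp u := by simpa using Real.one_le_exp hu
  have hy0 : (0 : ℝ) < Real.exp u := Real.exp_pos u
  have hyy : Real.exp u ≤ ρ * Real.exp u := le_mul_of_one_le_left hy0.le hρ1
  have hΔ : ‖psum c (ρ * Real.exp u) - psum c (Real.exp u)‖ ≤ Chebyshev.theta (ρ * Real.exp u) - Chebyshev.theta (Real.exp u) :=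
    norm_psum_sub_psum_le_theta hc hyy
  have hexpα : Real.exp (-(2 * (1 + α) * u)) ≤ Real.exp (-2 * u) := Real.exp_le_exp.2 (by nlinarith)
  have hcr := theta_sub_theta_le_crude hy1 hyy
  have hlog : Real.log (ρ * Real.exp u) ≤ u + 1 := by
    rw [Real.log_mul (by linarith) hy0.ne', Real.log_exp]
    have : Real.log ρ ≤ 1 := by
      calc Real.log ρ ≤ ρ - 1 := Real.log_le_sub_one_of_pos (by linarith)
        _ ≤ 1 := by rw [hρ]; linarith
    linarith
  have hb : ‖psum c (ρ * Real.exp u) - psum c (Real.exp u)‖ ≤ (δ * Real.exp u + 1) * (u + 1) := by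
    refine hΔ.trans (hcr.trans ?_)
    have h0 : 0 ≤ ρ * Real.exp u - Real.exp u + 1 := by nlinarith
    calc (ρ * Real.exp u - Real.exp u + 1) * Real.log (ρ * Real.exp u)
        ≤ (ρ * Real.exp u - Real.exp u + 1) * (u + 1) := mul_le_mul_of_nonneg_left hlog h0
      _ = (δ * Real.exp u + 1) * (u + 1) := by rw [hρ]; ring
  have h1 : ‖psum c (ρ * Real.exp u) - psum c (Real.exp u)‖ ^ 2 * Real.exp (-(2 * (1 + α) * u)) ≤
      ((δ * Real.exp u + 1) * (u + 1)) ^ 2 * Real.exp (-2 * u) := by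
    have := pow_le_pow_left₀ (norm_nonneg _) hb 2
    exact mul_le_mul this hexpα (Real.exp_pos _).le (by positivity)
  have hu1 : (u + 1) ^ 2 ≤ (u₀ + 1) ^ 2 := pow_le_pow_left₀ (by linarith) (by linarith) 2
  have hsq : (δ * Real.exp u + 1) ^ 2 ≤ 2 * (δ * Real.exp u) ^ 2 + 2 := by
    nlinarith [sq_nonneg (δ * Real.exp u - 1)]
  have hee : (δ * Real.exp u) ^ 2 * Real.exp (-2 * u) = δ ^ 2 := by
    have h1 : Real.exp u ^ 2 * Real.exp (-2 * u) = 1 := by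
      rw [← Real.exp_nat_mul, ← Real.exp_add]
      convert Real.exp_zero using 2
      push_cast; ring
    calc (δ * Real.exp u) ^ 2 * Real.exp (-2 * u) = δ ^ 2 * (Real.exp u ^ 2 * Real.exp (-2 * u)) := by ring
      _ = δ ^ 2 := by rw [h1, mul_one]
  have he0 : 0 ≤ Real.exp (-2 * u) := (Real.exp_pos _).le
  calc ‖psum c (ρ * Real.exp u) - psum c (Real.exp u)‖ ^ 2 * Real.exp (-(2 * (1 + α) * u))
      ≤ ((δ * Real.exp u + 1) * (u + 1)) ^ 2 * Real.exp (-2 * u) := h1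
    _ = (δ * Real.exp u + 1) ^ 2 * (u + 1) ^ 2 * Real.exp (-2 * u) := by ring
    _ ≤ (2 * (δ * Real.exp u) ^ 2 + 2) * (u₀ + 1) ^ 2 * Real.exp (-2 * u) := by gcongr
    _ = 2 * (u₀ + 1) ^ 2 * ((δ * Real.exp u) ^ 2 * Real.exp (-2 * u)) +
          2 * (u₀ + 1) ^ 2 * Real.exp (-2 * u) := by ring
    _ = 2 * (u₀ + 1) ^ 2 * δ ^ 2 + 2 * (u₀ + 1) ^ 2 * Real.exp (-2 * u) := by rw [hee]

omit hσ hsum in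
/-- The pointwise bound in the PNT range: if `θ(ρ e^u) - θ(e^u) ≤ 2δ e^u` (`u ≥ 0`) then
`‖Δ(e^u)‖² e^{-2(1+α)u} ≤ 4δ² e^{-2αu}`. [folklore] -/
theorem normSq_psumDiff_exp_le_pnt (hc : ∀ n : ℕ, ‖c n‖ ≤ if n.Prime then Real.log n else 0) {δ : ℝ} (hδ0 : 0 ≤ δ) {α u : ℝ}
    (hPNT : Chebyshev.theta ((1 + δ) * Real.exp u) - Chebyshev.theta (Real.exp u) ≤ 2 * δ * Real.exp u) :
    ‖psum c ((1 + δ) * Real.exp u) - psum c (Real.exp u)‖ ^ 2 * Real.exp (-(2 * (1 + α) * u)) ≤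
      4 * δ ^ 2 * Real.exp (-(2 * α) * u) := by
  have hy0 : (0 : ℝ) < Real.exp u := Real.exp_pos u
  have hyy : Real.exp u ≤ (1 + δ) * Real.exp u := le_mul_of_one_le_left hy0.le (by linarith)
  have hb : ‖psum c ((1 + δ) * Real.exp u) - psum c (Real.exp u)‖ ≤ 2 * δ * Real.exp u :=
    (norm_psum_sub_psum_le_theta hc hyy).trans hPNT
  have hexp2 : Real.exp u ^ 2 * Real.exp (-(2 * (1 + α) * u)) = Real.exp (-(2 * α) * u) := by
    rw [sq, ← Real.exp_add, ← Real.exp_add]; congr 1; ring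
  calc ‖psum c ((1 + δ) * Real.exp u) - psum c (Real.exp u)‖ ^ 2 * Real.exp (-(2 * (1 + α) * u))
      ≤ (2 * δ * Real.exp u) ^ 2 * Real.exp (-(2 * (1 + α) * u)) := by
        have := pow_le_pow_left₀ (norm_nonneg _) hb 2
        exact mul_le_mul_of_nonneg_right this (Real.exp_pos _).le
    _ = 4 * δ ^ 2 * (Real.exp u ^ 2 * Real.exp (-(2 * (1 + α) * u))) := by ring
    _ = 4 * δ ^ 2 * Real.exp (-(2 * α) * u) := by rw [hexp2]

omit hσ hsum in
/-- **Mean square of short differences of a prime-supported sequence living below `Q`.**  As in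
`integral_norm_sq_psumDiff_prime_le`, but for `c` supported on (primes) `n ≤ Q` (`Q ≥ 1`): the short
differences vanish for `e^u ≥ Q`, and
`∫_ℝ |A(ρe^u) - A(e^u)|² e^{-2(1+α)u} du ≤ (u₀ + 1)² (2δ²u₀ + 1) + 4δ² log Q` — no `1/α` at all.
(For the block pieces `g(p) log p 1_{p ∈ [P, Q]}` of the logarithmic derivative.) [folklore] -/
theorem integral_norm_sq_psumDiff_prime_le_of_le (hc : ∀ n : ℕ, ‖c n‖ ≤ if n.Prime then Real.log n else 0) {Q : ℝ} (hQ : 1 ≤ Q)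
    (hsupp : ∀ n : ℕ, c n ≠ 0 → (n : ℝ) ≤ Q) {δ : ℝ} (hδ0 : 0 < δ) (hδ1 : δ ≤ 1)
    {α : ℝ} (hα : 0 < α) {u₀ : ℝ} (hu₀ : 0 ≤ u₀)
    (hPNT : ∀ y : ℝ, Real.exp u₀ ≤ y → Chebyshev.theta ((1 + δ) * y) - Chebyshev.theta y ≤ 2 * δ * y) :
    ∫ u : ℝ, ‖psum c ((1 + δ) * Real.exp u) - psum c (Real.exp u)‖ ^ 2 * Real.exp (-(2 * (1 + α) * u)) ≤
      (u₀ + 1) ^ 2 * (2 * δ ^ 2 * u₀ + 1) + 4 * δ ^ 2 * Real.log Q := by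
  set ρ : ℝ := 1 + δ with hρ
  have hρ1 : 1 ≤ ρ := by rw [hρ]; linarith
  have hρ2 : ρ ≤ 2 := by rw [hρ]; linarith
  have hc1 : c 1 = 0 := eq_zero_of_not_prime_of_primeLogBound hc Nat.not_prime_one
  have hlogQ : 0 ≤ Real.log Q := Real.log_nonneg hQ
  set F₁ : ℝ → ℝ := (Set.Icc 0 u₀).indicator (fun _ => 2 * (u₀ + 1) ^ 2 * δ ^ 2) with hF₁
  set F₂ : ℝ → ℝ := (Set.Ici (0 : ℝ)).indicator (fun u => 2 * (u₀ + 1) ^ 2 * Real.exp (-2 * u)) with hF₂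
  set F₃ : ℝ → ℝ := (Set.Icc 0 (Real.log Q)).indicator (fun _ => 4 * δ ^ 2) with hF₃
  have hF₁i : Integrable F₁ := by
    rw [hF₁, integrable_indicator_iff measurableSet_Icc]
    exact integrableOn_const (by rw [Real.volume_Icc]; exact ENNReal.ofReal_ne_top)
  have hF₂i : Integrable F₂ := by
    rw [hF₂, integrable_indicator_iff measurableSet_Ici, integrableOn_Ici_iff_integrableOn_Ioi]
    exact (integrableOn_exp_mul_Ioi (by norm_num : (-2 : ℝ) < 0) 0).const_mul _
  have hF₃i : Integrable F₃ := by
    rw [hF₃, integrable_indicator_iff measurableSet_Icc]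
    exact integrableOn_const (by rw [Real.volume_Icc]; exact ENNReal.ofReal_ne_top)
  have hI₁ : ∫ u, F₁ u = 2 * (u₀ + 1) ^ 2 * δ ^ 2 * u₀ := by
    rw [hF₁, integral_indicator measurableSet_Icc, setIntegral_const, Real.volume_real_Icc_of_le hu₀,
      smul_eq_mul]
    ring
  have hI₂ : ∫ u, F₂ u = (u₀ + 1) ^ 2 := by
    rw [hF₂, integral_indicator measurableSet_Ici, integral_Ici_eq_integral_Ioi, integral_const_mul,
      integral_exp_mul_Ioi (by norm_num : (-2 : ℝ) < 0) 0]
    simp only [mul_zero, Real.exp_zero]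
    ring
  have hI₃ : ∫ u, F₃ u = 4 * δ ^ 2 * Real.log Q := by
    rw [hF₃, integral_indicator measurableSet_Icc, setIntegral_const, Real.volume_real_Icc_of_le hlogQ,
      smul_eq_mul]
    ring
  have hle : ∀ u : ℝ, ‖psum c (ρ * Real.exp u) - psum c (Real.exp u)‖ ^ 2 * Real.exp (-(2 * (1 + α) * u)) ≤ F₁ u + F₂ u + F₃ u := by
    intro u
    have h10 : 0 ≤ F₁ u := by rw [hF₁]; exact Set.indicator_nonneg (fun _ _ => by positivity) u
    have h20 : 0 ≤ F₂ u := by rw [hF₂]; exact Set.indicator_nonneg (fun _ _ => by positivity) u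
    have h30 : 0 ≤ F₃ u := by rw [hF₃]; exact Set.indicator_nonneg (fun _ _ => by positivity) u
    rcases lt_or_ge u 0 with hu | hu
    · rw [psumDiff_exp_of_neg hc1 hρ2 hu, norm_zero]
      simp only [ne_eq, OfNat.ofNat_ne_zero, not_false_eq_true, zero_pow, zero_mul]
      linarith
    rcases le_or_gt (Real.log Q) u with hQu | hQu
    · -- beyond `log Q` the difference vanishes
      have hy : Q ≤ Real.exp u := by
        calc Q = Real.exp (Real.log Q) := (Real.exp_log (by linarith)).symm
          _ ≤ Real.exp u := Real.exp_le_exp.2 hQu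
      rw [psumDiff_eq_zero_of_ge hsupp hρ1 (by linarith) hy, norm_zero]
      simp only [ne_eq, OfNat.ofNat_ne_zero, not_false_eq_true, zero_pow, zero_mul]
      linarith
    rcases le_or_gt u u₀ with hu₀' | hu₀'
    · have hF₁u : F₁ u = 2 * (u₀ + 1) ^ 2 * δ ^ 2 := by
        rw [hF₁, Set.indicator_of_mem (Set.mem_Icc.2 ⟨hu, hu₀'⟩)]
      have hF₂u : F₂ u = 2 * (u₀ + 1) ^ 2 * Real.exp (-2 * u) := by rw [hF₂, Set.indicator_of_mem (Set.mem_Ici.2 hu)]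
      have := normSq_psumDiff_exp_le_crude hc hδ0.le hδ1 hα.le hu hu₀'
      rw [hF₁u, hF₂u]
      linarith
    · have hF₃u : F₃ u = 4 * δ ^ 2 := by
        rw [hF₃, Set.indicator_of_mem (Set.mem_Icc.2 ⟨hu, hQu.le⟩)]
      have hyu₀ : Real.exp u₀ ≤ Real.exp u := Real.exp_le_exp.2 hu₀'.le
      have := normSq_psumDiff_exp_le_pnt hc hδ0.le (α := α) (hPNT _ hyu₀)
      have h4 : 4 * δ ^ 2 * Real.exp (-(2 * α) * u) ≤ 4 * δ ^ 2 := by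
        have : Real.exp (-(2 * α) * u) ≤ 1 := Real.exp_le_one_iff.2 (by nlinarith)
        have h0 : 0 ≤ 4 * δ ^ 2 := by positivity
        nlinarith
      rw [hF₃u]
      linarith
  have hnonneg : 0 ≤ᵐ[volume] fun u : ℝ => ‖psum c (ρ * Real.exp u) - psum c (Real.exp u)‖ ^ 2 * Real.exp (-(2 * (1 + α) * u)) :=
    Filter.Eventually.of_forall fun u => by positivity
  calc ∫ u : ℝ, ‖psum c (ρ * Real.exp u) - psum c (Real.exp u)‖ ^ 2 * Real.exp (-(2 * (1 + α) * u))
      ≤ ∫ u, (F₁ u + F₂ u + F₃ u) :=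
        integral_mono_of_nonneg hnonneg ((hF₁i.add hF₂i).add hF₃i) (Filter.Eventually.of_forall hle)
    _ = (∫ u, F₁ u) + (∫ u, F₂ u) + ∫ u, F₃ u := by
        rw [integral_add (f := fun u => F₁ u + F₂ u) (g := F₃) (hF₁i.add hF₂i) hF₃i, integral_add hF₁i hF₂i]
    _ = (u₀ + 1) ^ 2 * (2 * δ ^ 2 * u₀ + 1) + 4 * δ ^ 2 * Real.log Q := by rw [hI₁, hI₂, hI₃]; ring

/-! ### The same mean values on the Dirichlet-series side -/

omit hσ hsum in
/-- `∑ ‖c(n)‖ n^{-σ} < ∞` for `σ > 1` when `‖c(n)‖ ≤ log n` on primes (indeed `≤ log n` everywhere). [folklore] -/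
theorem summable_norm_div_rpow_of_primeLogBound (hc : ∀ n : ℕ, ‖c n‖ ≤ if n.Prime then Real.log n else 0) {σ' : ℝ} (hσ' : 1 < σ') :
    Summable fun n : ℕ => ‖c n‖ / (n : ℝ) ^ σ' := by
  -- `log n ≤ n^ε/ε` with `ε = (σ' - 1)/2`, so the terms are `≤ (1/ε) n^{-(1 + ε)}`
  set ε : ℝ := (σ' - 1) / 2 with hε
  have hε0 : 0 < ε := by rw [hε]; linarith
  have hsum : Summable fun n : ℕ => 1 / ε * ((n : ℝ) ^ (1 + ε))⁻¹ :=
    ((Real.summable_nat_rpow_inv.2 (by linarith)).mul_left (1 / ε))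
  refine Summable.of_nonneg_of_le (fun n => by positivity) (fun n => ?_) hsum
  rcases Nat.eq_zero_or_pos n with rfl | hn
  · simp [Real.zero_rpow (by linarith : σ' ≠ 0), Real.zero_rpow (by linarith : 1 + ε ≠ 0)]
  have hn0 : (0 : ℝ) < n := by exact_mod_cast hn
  have h1 : ‖c n‖ ≤ Real.log n := by
    refine (hc n).trans ?_
    split_ifs
    · exact le_rfl
    · exact Real.log_nonneg (by exact_mod_cast hn)
  have h2 : Real.log n ≤ (n : ℝ) ^ ε / ε := Real.log_le_rpow_div hn0.le hε0
  calc ‖c n‖ / (n : ℝ) ^ σ' ≤ ((n : ℝ) ^ ε / ε) / (n : ℝ) ^ σ' := by gcongr; exact h1.trans h2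
    _ = 1 / ε * ((n : ℝ) ^ (1 + ε))⁻¹ := by
        have : (n : ℝ) ^ σ' = (n : ℝ) ^ ε * (n : ℝ) ^ (1 + ε) := by
          rw [← Real.rpow_add hn0]; congr 1; rw [hε]; ring
        rw [this]
        field_simp

omit hσ hsum in
/-- Growth of the partial sums of a prime-supported sequence: `‖A(y)‖ ≤ θ(y) ≤ 2y` (`y ≥ 1`). [folklore] -/
theorem norm_psum_le_of_primeLogBound (hc : ∀ n : ℕ, ‖c n‖ ≤ if n.Prime then Real.log n else 0) {y : ℝ} (hy : 1 ≤ y) :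
    ‖psum c y‖ ≤ 2 * y ^ (1 : ℝ) := by
  have h0 : psum c 0 = 0 := psum_of_lt_one c (by norm_num)
  have h1 := norm_psum_sub_psum_le_theta hc (y := 0) (y' := y) (by linarith)
  rw [h0, sub_zero, Chebyshev.theta_zero, sub_zero] at h1
  refine h1.trans ((Chebyshev.theta_le_log4_mul_x (by linarith)).trans ?_)
  rw [Real.rpow_one]
  have : Real.log 4 ≤ 2 := by
    have h := Real.log_le_sub_one_of_pos (show (0:ℝ) < 4 by norm_num)
    have h2 : Real.log 4 = 2 * Real.log 2 := by
      rw [show (4:ℝ) = 2 ^ 2 by norm_num, Real.log_pow]; ring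
    rw [h2]; have := Real.log_two_lt_d9; linarith
  nlinarith

omit hσ hsum in
/-- **The multiplier-weighted mean value of `∑ c(n) n^{-s}`, general prime-supported `c`**: with
`ρ = 1 + δ` and the hypotheses of `integral_norm_sq_psumDiff_prime_le`,
`∫_ℝ |ρ^s - 1|² |L_c(s)|²/|s|² dy ≤ 2π ((u₀+1)²(2δ²u₀+1) + 2δ²/α)` on `s = 1 + α + iy`
(Plancherel back to the physical side). [folklore] -/
theorem integral_mult_normSq_LSeries_prime_le (hc : ∀ n : ℕ, ‖c n‖ ≤ if n.Prime then Real.log n else 0) {δ : ℝ} (hδ0 : 0 < δ) (hδ1 : δ ≤ 1)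
    {α : ℝ} (hα : 0 < α) {u₀ : ℝ} (hu₀ : 0 ≤ u₀)
    (hPNT : ∀ y : ℝ, Real.exp u₀ ≤ y → Chebyshev.theta ((1 + δ) * y) - Chebyshev.theta y ≤ 2 * δ * y) :
    ∫ y : ℝ, ‖((1 + δ : ℝ) : ℂ) ^ ((1 : ℂ) + α + y * I) - 1‖ ^ 2 *
        ‖LSeries c (1 + α + y * I)‖ ^ 2 / ‖(1 : ℂ) + α + y * I‖ ^ 2 ≤
      2 * π * ((u₀ + 1) ^ 2 * (2 * δ ^ 2 * u₀ + 1) + 2 * δ ^ 2 / α) := by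
  have hσ1 : (0 : ℝ) < 1 + α := by linarith
  have hP := integral_norm_sq_psumDiff_exp (a := c) (σ := 1 + α) (θ := 1) (C := 2) (ρ := 1 + δ) hσ1
    (summable_norm_div_rpow_of_primeLogBound hc (by linarith)) (by linarith) (fun y hy => norm_psum_le_of_primeLogBound hc hy) (by linarith)
  have hW := integral_norm_sq_psumDiff_prime_le hc hδ0 hδ1 hα hu₀ hPNT
  have hcast : ∀ y : ℝ, ((1 + α : ℝ) : ℂ) + y * I = (1 : ℂ) + α + y * I := fun y => by push_cast; ring
  have heq : ∫ y : ℝ, ‖((1 + δ : ℝ) : ℂ) ^ ((1 : ℂ) + α + y * I) - 1‖ ^ 2 *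
        ‖LSeries c (1 + α + y * I)‖ ^ 2 / ‖(1 : ℂ) + α + y * I‖ ^ 2 =
      ∫ y : ℝ, ‖((1 + δ : ℝ) : ℂ) ^ (((1 + α : ℝ) : ℂ) + y * I) - 1‖ ^ 2 *
        ‖LSeries c ((1 + α : ℝ) + y * I)‖ ^ 2 / ‖((1 + α : ℝ) : ℂ) + y * I‖ ^ 2 := by
    refine integral_congr_ae (Filter.Eventually.of_forall fun y => ?_)
    simp only [hcast]
  rw [heq]
  have hpos : (0 : ℝ) < 2 * π := by positivity
  have := mul_le_mul_of_nonneg_left hW hpos.le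
  rw [hP, ← mul_assoc, mul_one_div_cancel hpos.ne', one_mul] at this
  exact this

omit hσ hsum in
/-- **The multiplier-weighted mean value, prime-supported `c` below `Q`**:
`∫_ℝ |ρ^s - 1|² |L_c(s)|²/|s|² dy ≤ 2π ((u₀+1)²(2δ²u₀+1) + 4δ² log Q)` on `s = 1 + α + iy`. [folklore] -/
theorem integral_mult_normSq_LSeries_prime_le_of_le (hc : ∀ n : ℕ, ‖c n‖ ≤ if n.Prime then Real.log n else 0) {Q : ℝ} (hQ : 1 ≤ Q)
    (hsupp : ∀ n : ℕ, c n ≠ 0 → (n : ℝ) ≤ Q) {δ : ℝ} (hδ0 : 0 < δ) (hδ1 : δ ≤ 1)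
    {α : ℝ} (hα : 0 < α) {u₀ : ℝ} (hu₀ : 0 ≤ u₀)
    (hPNT : ∀ y : ℝ, Real.exp u₀ ≤ y → Chebyshev.theta ((1 + δ) * y) - Chebyshev.theta y ≤ 2 * δ * y) :
    ∫ y : ℝ, ‖((1 + δ : ℝ) : ℂ) ^ ((1 : ℂ) + α + y * I) - 1‖ ^ 2 *
        ‖LSeries c (1 + α + y * I)‖ ^ 2 / ‖(1 : ℂ) + α + y * I‖ ^ 2 ≤
      2 * π * ((u₀ + 1) ^ 2 * (2 * δ ^ 2 * u₀ + 1) + 4 * δ ^ 2 * Real.log Q) := by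
  have hσ1 : (0 : ℝ) < 1 + α := by linarith
  have hP := integral_norm_sq_psumDiff_exp (a := c) (σ := 1 + α) (θ := 1) (C := 2) (ρ := 1 + δ) hσ1
    (summable_norm_div_rpow_of_primeLogBound hc (by linarith)) (by linarith) (fun y hy => norm_psum_le_of_primeLogBound hc hy) (by linarith)
  have hW := integral_norm_sq_psumDiff_prime_le_of_le hc hQ hsupp hδ0 hδ1 hα hu₀ hPNT
  have hcast : ∀ y : ℝ, ((1 + α : ℝ) : ℂ) + y * I = (1 : ℂ) + α + y * I := fun y => by push_cast; ring
  have heq : ∫ y : ℝ, ‖((1 + δ : ℝ) : ℂ) ^ ((1 : ℂ) + α + y * I) - 1‖ ^ 2 *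
        ‖LSeries c (1 + α + y * I)‖ ^ 2 / ‖(1 : ℂ) + α + y * I‖ ^ 2 =
      ∫ y : ℝ, ‖((1 + δ : ℝ) : ℂ) ^ (((1 + α : ℝ) : ℂ) + y * I) - 1‖ ^ 2 *
        ‖LSeries c ((1 + α : ℝ) + y * I)‖ ^ 2 / ‖((1 + α : ℝ) : ℂ) + y * I‖ ^ 2 := by
    refine integral_congr_ae (Filter.Eventually.of_forall fun y => ?_)
    simp only [hcast]
  rw [heq]
  have hpos : (0 : ℝ) < 2 * π := by positivity
  have := mul_le_mul_of_nonneg_left hW hpos.le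
  rw [hP, ← mul_assoc, mul_one_div_cancel hpos.ne', one_mul] at this
  exact this

/-! ### The prime number theorem in short intervals, in the form consumed above -/

omit hσ hsum in
/-- **PNT in short intervals** (from the de la Vallée Poussin prime number theorem of the tree,
`ChebyshevThetaDeLaValleePoussin_holds.logPow 2`): there is an absolute `C ≥ 0` such that for
`0 < δ ≤ 1` and `y ≥ 2` with `log² y ≥ C/δ`, `θ((1+δ)y) - θ(y) ≤ 2δy`. [folklore] -/
theorem exists_theta_shortInterval_le :
    ∃ C : ℝ, 0 ≤ C ∧ ∀ (δ y : ℝ), 0 < δ → δ ≤ 1 → 2 ≤ y → C / δ ≤ Real.log y ^ 2 →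
      Chebyshev.theta ((1 + δ) * y) - Chebyshev.theta y ≤ 2 * δ * y := by
  obtain ⟨C₀, hC₀⟩ := ChebyshevThetaDeLaValleePoussin_holds.logPow 2
  -- `C₀ ≥ 0` may be assumed
  have hC : ∀ x : ℝ, 2 ≤ x → |Chebyshev.theta x - x| ≤ max C₀ 0 * x / Real.log x ^ 2 := by
    intro x hx
    have h := hC₀ x hx
    rw [Real.rpow_two] at h
    refine h.trans ?_
    have : 0 < Real.log x ^ 2 := by
      have := Real.log_pos (by linarith : (1:ℝ) < x); positivity
    rw [div_le_div_iff_of_pos_right this]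
    exact mul_le_mul_of_nonneg_right (le_max_left _ _) (by linarith)
  refine ⟨3 * max C₀ 0, by positivity, fun δ y hδ0 hδ1 hy hlog => ?_⟩
  set C : ℝ := max C₀ 0 with hCdef
  have hC0 : 0 ≤ C := le_max_right _ _
  have hy' : 2 ≤ (1 + δ) * y := by nlinarith
  have h1 := hC ((1 + δ) * y) hy'
  have h2 := hC y hy
  have hlogy : 0 < Real.log y := Real.log_pos (by linarith)
  have hlogy' : Real.log y ≤ Real.log ((1 + δ) * y) := Real.log_le_log (by linarith) (by nlinarith)
  have hl2 : Real.log y ^ 2 ≤ Real.log ((1 + δ) * y) ^ 2 := pow_le_pow_left₀ hlogy.le hlogy' 2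
  have hpos : 0 < Real.log y ^ 2 := by positivity
  -- `|θ(ρy) - ρy| ≤ C ρ y/log²(ρy) ≤ 2C y/log² y` and `|θ(y) - y| ≤ C y/log² y`
  have e1 : C * ((1 + δ) * y) / Real.log ((1 + δ) * y) ^ 2 ≤ 2 * C * y / Real.log y ^ 2 := by
    calc C * ((1 + δ) * y) / Real.log ((1 + δ) * y) ^ 2 ≤ C * ((1 + δ) * y) / Real.log y ^ 2 := by
          apply div_le_div_of_nonneg_left (by positivity) hpos hl2
      _ ≤ 2 * C * y / Real.log y ^ 2 := by
          rw [div_le_div_iff_of_pos_right hpos]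
          have hCy : 0 ≤ C * y := mul_nonneg hC0 (by linarith)
          have : C * ((1 + δ) * y) = C * y + δ * (C * y) := by ring
          rw [this]
          nlinarith
  have e3 : 3 * C * y / Real.log y ^ 2 ≤ δ * y := by
    rw [div_le_iff₀ hpos]
    have : 3 * C ≤ δ * Real.log y ^ 2 := by
      have := (div_le_iff₀' hδ0).1 hlog  -- `3C ≤ δ log² y`
      linarith
    nlinarith
  have a1 := (abs_le.1 (h1.trans e1)).2
  have a2 := (abs_le.1 h2).1
  have : Chebyshev.theta ((1 + δ) * y) - Chebyshev.theta y ≤ δ * y + 3 * C * y / Real.log y ^ 2 := by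
    have e4 : 2 * C * y / Real.log y ^ 2 + C * y / Real.log y ^ 2 = 3 * C * y / Real.log y ^ 2 := by ring
    linarith
  linarith

/-! ### The prime-power part of the logarithmic derivative is bounded -/

omit hσ hsum in
/-- **Prime powers `p^k`, `k ≥ 2`, contribute boundedly**: if `‖c(n)‖ ≤ Λ(n)` at non-primes and `c = 0` on
primes, then `‖∑ c(n) n^{-s}‖ ≤ 2` for `Re s ≥ 1` (from `∑_p log p/(p(p-1)) ≤ 2`, tree
`MertensBound.sum_log_div_mul_pred_le_two`). [folklore] -/
theorem norm_LSeries_primePow_le {c : ℕ → ℂ}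
    (hc : ∀ n : ℕ, ‖c n‖ ≤ if n.Prime then 0 else (ArithmeticFunction.vonMangoldt n : ℝ))
    {s : ℂ} (hs : 1 ≤ s.re) : ‖LSeries c s‖ ≤ 2 := by
  -- finite partial sums of the majorant are `≤ 2`
  have hfin : ∀ N : ℕ, ∑ n ∈ Finset.range N, ‖LSeries.term c s n‖ ≤ 2 := by
    intro N
    -- compare with the sum over pairs `(p, k)`, `p ≤ N` prime, `2 ≤ k ≤ N`, of `log p / p^k`
    have hterm : ∀ n ∈ Finset.range N, ‖LSeries.term c s n‖ ≤
        if ¬(n.Prime ∨ ArithmeticFunction.vonMangoldt n = 0) then (ArithmeticFunction.vonMangoldt n : ℝ) / n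
        else 0 := by
      intro n _
      rcases Nat.eq_zero_or_pos n with rfl | hn
      · simp [LSeries.term_zero]
      rw [LSeries.term_of_ne_zero hn.ne', norm_div, Complex.norm_natCast_cpow_of_pos hn]
      have hcn := hc n
      by_cases h : n.Prime ∨ ArithmeticFunction.vonMangoldt n = 0
      · rw [if_neg (not_not.2 h)]
        rcases h with hp | hΛ
        · rw [if_pos hp] at hcn
          have : ‖c n‖ = 0 := le_antisymm hcn (norm_nonneg _)
          rw [this, zero_div]
        · have : ‖c n‖ = 0 := by
            refine le_antisymm (hcn.trans ?_) (norm_nonneg _)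
            split_ifs
            · exact le_rfl
            · rw [hΛ]
          rw [this, zero_div]
      · rw [if_pos h]
        rw [if_neg (not_or.1 h).1] at hcn
        calc ‖c n‖ / (n : ℝ) ^ s.re ≤ (ArithmeticFunction.vonMangoldt n : ℝ) / (n : ℝ) ^ s.re := by gcongr
          _ ≤ (ArithmeticFunction.vonMangoldt n : ℝ) / (n : ℝ) ^ (1 : ℝ) := by
              apply div_le_div_of_nonneg_left ArithmeticFunction.vonMangoldt_nonneg (by positivity)
              exact Real.rpow_le_rpow_of_exponent_le (by exact_mod_cast hn) hs
          _ = (ArithmeticFunction.vonMangoldt n : ℝ) / n := by rw [Real.rpow_one]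
    refine (Finset.sum_le_sum hterm).trans ?_
    rw [← Finset.sum_filter]
    -- the filtered set is contained in the image of `(p, k) ↦ p^k`
    set S := (Finset.range N).filter (fun n => ¬(n.Prime ∨ ArithmeticFunction.vonMangoldt n = 0)) with hS
    set g : ℕ × ℕ → ℕ := fun pk => pk.1 ^ pk.2 with hg
    set D := (Nat.primesLE N) ×ˢ Finset.Icc 2 N with hD
    have hsub : S ⊆ D.image g := by
      intro n hn
      rw [hS, Finset.mem_filter, Finset.mem_range] at hn
      obtain ⟨hnN, hn⟩ := hn
      push Not at hn
      have hΛ : (ArithmeticFunction.vonMangoldt n : ℝ) ≠ 0 := hn.2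
      obtain ⟨p, k, hp, hk, rfl⟩ :=
        Literature.NumberTheory.LFunctions.Halasz.Restricted.exists_eq_pow_of_vonMangoldt_ne_zero hΛ
      have hk2 : 2 ≤ k := by
        by_contra h
        have : k = 1 := by omega
        subst this
        exact hn.1 (by simpa using hp)
      rw [Finset.mem_image]
      refine ⟨(p, k), ?_, rfl⟩
      rw [hD, Finset.mem_product, Nat.mem_primesLE, Finset.mem_Icc]
      have hppk : p ≤ p ^ k := Nat.le_self_pow (by omega) p
      have hkpk : k < p ^ k := Nat.lt_pow_self hp.one_lt
      exact ⟨⟨by omega, hp⟩, hk2, by omega⟩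
    have hnn : ∀ n ∈ D.image g, 0 ≤ (ArithmeticFunction.vonMangoldt n : ℝ) / n := fun n _ =>
      div_nonneg ArithmeticFunction.vonMangoldt_nonneg (Nat.cast_nonneg _)
    calc ∑ n ∈ S, (ArithmeticFunction.vonMangoldt n : ℝ) / n
        ≤ ∑ n ∈ D.image g, (ArithmeticFunction.vonMangoldt n : ℝ) / n :=
          Finset.sum_le_sum_of_subset_of_nonneg hsub (fun n hn _ => hnn n hn)
      _ ≤ ∑ pk ∈ D, (ArithmeticFunction.vonMangoldt (g pk) : ℝ) / (g pk : ℕ) :=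
          Finset.sum_image_le_of_nonneg hnn
      _ = ∑ p ∈ Nat.primesLE N, ∑ k ∈ Finset.Icc 2 N, Real.log p / (p : ℝ) ^ k := by
          rw [hD, Finset.sum_product]
          refine Finset.sum_congr rfl fun p hp => Finset.sum_congr rfl fun k hk => ?_
          rw [Nat.mem_primesLE] at hp
          rw [Finset.mem_Icc] at hk
          simp only [hg]
          rw [ArithmeticFunction.vonMangoldt_apply_pow (by omega), ArithmeticFunction.vonMangoldt_apply_prime hp.2]
          push_cast
          rfl
      _ ≤ ∑ p ∈ Nat.primesLE N, Real.log p / (p * (p - 1)) := by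
          refine Finset.sum_le_sum fun p hp => ?_
          rw [Nat.mem_primesLE] at hp
          have hp2 : (2 : ℝ) ≤ p := by exact_mod_cast hp.2.two_le
          have hlogp : 0 ≤ Real.log p := Real.log_nonneg (by linarith)
          -- geometric tail: `∑_{k=2}^{N} p^{-k} ≤ 1/(p(p-1))`
          have hgeom : ∑ k ∈ Finset.Icc 2 N, ((p : ℝ) ^ k)⁻¹ ≤ 1 / (p * (p - 1)) := by
            have hr : ((p : ℝ))⁻¹ < 1 := by rw [inv_lt_one_iff₀]; right; linarith
            have hr0 : 0 ≤ ((p : ℝ))⁻¹ := by positivity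
            have h1 : ∑ k ∈ Finset.Icc 2 N, ((p : ℝ) ^ k)⁻¹ = ∑ k ∈ Finset.Icc 2 N, ((p : ℝ)⁻¹) ^ k := by
              refine Finset.sum_congr rfl fun k _ => ?_; rw [inv_pow]
            rw [h1]
            have h2 : ∑ k ∈ Finset.Icc 2 N, ((p : ℝ)⁻¹) ^ k ≤ ∑' k : ℕ, ((p : ℝ)⁻¹) ^ (k + 2) := by
              have hs : Summable fun k : ℕ => ((p : ℝ)⁻¹) ^ (k + 2) := by
                simp_rw [pow_add]
                exact (summable_geometric_of_lt_one hr0 hr).mul_right _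
              calc ∑ k ∈ Finset.Icc 2 N, ((p : ℝ)⁻¹) ^ k
                  = ∑ k ∈ (Finset.Icc 2 N).image (fun k => k - 2), ((p : ℝ)⁻¹) ^ (k + 2) := by
                    rw [Finset.sum_image]
                    · refine Finset.sum_congr rfl fun k hk => ?_
                      rw [Finset.mem_Icc] at hk
                      congr 1; omega
                    · intro a ha b hb hab
                      rw [Finset.coe_Icc, Set.mem_Icc] at ha hb
                      simp only at hab
                      omega
                _ ≤ ∑' k : ℕ, ((p : ℝ)⁻¹) ^ (k + 2) :=
                    hs.sum_le_tsum _ (fun k _ => by positivity)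
            refine h2.trans (le_of_eq ?_)
            rw [show (fun k : ℕ => ((p : ℝ)⁻¹) ^ (k + 2)) = fun k => ((p : ℝ)⁻¹) ^ 2 * ((p : ℝ)⁻¹) ^ k by
              funext k; ring, tsum_mul_left, tsum_geometric_of_lt_one hr0 hr]
            have hp0 : (p : ℝ) ≠ 0 := by positivity
            have hp1 : (p : ℝ) - 1 ≠ 0 := by linarith
            field_simp
          calc ∑ k ∈ Finset.Icc 2 N, Real.log p / (p : ℝ) ^ k
              = Real.log p * ∑ k ∈ Finset.Icc 2 N, ((p : ℝ) ^ k)⁻¹ := by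
                rw [Finset.mul_sum]; refine Finset.sum_congr rfl fun k _ => ?_; rw [div_eq_mul_inv]
            _ ≤ Real.log p * (1 / (p * (p - 1))) := mul_le_mul_of_nonneg_left hgeom hlogp
            _ = Real.log p / (p * (p - 1)) := by ring
      _ ≤ 2 := Literature.NumberTheory.LFunctions.MertensBound.sum_log_div_mul_pred_le_two N
  -- summability of the terms and the bound
  have hsumm : Summable fun n : ℕ => ‖LSeries.term c s n‖ := by
    refine summable_of_sum_range_le (fun n => norm_nonneg _) hfin
  calc ‖LSeries c s‖ = ‖∑' n, LSeries.term c s n‖ := rfl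
    _ ≤ ∑' n, ‖LSeries.term c s n‖ := norm_tsum_le_tsum_norm hsumm
    _ ≤ 2 := hsumm.tsum_le_of_sum_range_le hfin

end MellinPlancherel

end Literature.NumberTheory.LFunctions
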